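import Literature.Analysis.FluidPDE.NSBoundedMildOseen
import Literature.Analysis.FluidPDE.KochTataruPairing
import Literature.Analysis.FluidPDE.MildL3Restart
import Literature.Analysis.FluidPDE.BoundedAnnihilator
import Literature.Analysis.FluidPDE.KatoUniqueness
import Literature.Analysis.FluidPDE.MildL3Smooth
import HarnessLib

/-!
# The Oseen Duhamel term of bounded fields, and bounded Besov mild solutions up to a drift (A1)

Analysis/FluidPDE proofs file for the decomposition `NSBoundedMildOseen.lean` of the smoothing
fact `Literature.Analysis.FluidPDE.knss_classical_of_bounded_isBesovMildSolutionOn`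
(Koch–Nadirashvili–Seregin–Šverák 2009, §4), first layer of the named fact **(A)**
`oseenMild_of_bounded_isBesovMildSolutionOn` (duality form ⇒ Oseen integral form). Everything is
proved; no named facts.

* `§ Majorant`, `§ Bounded`: the bilinear Duhamel term
  `B^ν_s(u,v)(t) = oseenDuhamel ν s u v t` of **bounded** jointly measurable fields on `(s, T) × E`
  (general viscosity `ν > 0`, initial time `s`, any finite-dimensional `E`): the majorant
  `∫ₛᵗ∫ ‖K(ν(t-τ), x-y)[u, v]‖ ≤ C M² ν^{-1/2} 2√(t-s)` from Koch–Tataru's kernel bound (14)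
  (`exists_lintegral_enorm_oseenKernel_bounded_le`; KNSS 2009, §4 p. 8:
  `‖B(u,v)‖_∞ ≤ C√T ‖u‖_∞‖v‖_∞`), absolute convergence, the product form, the sup bound
  (`exists_norm_oseenDuhamel_bounded_le`), the Fubini identity against continuous compactly
  supported fields (`integral_inner_oseenDuhamel_eq_setIntegral`), the **tested identities**
  `∫⟪B^ν_s(u,v)(t), φ⟫ = -∫ₛᵗ∫⟪v, D(e^{ν(t-τ)Δ}φ) u⟫` for solenoidal `φ`
  (`integral_inner_oseenDuhamel_of_isDivFree`, from the adjoint identity of the kernel,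
  `KochTataruPairing.lean`), its duality form
  `∫⟪B^ν_s(u,u)(t), φ⟫ = -∫ₛᵗ∫⟪u(τ), (u(τ)·∇)e^{ν(t-τ)Δ}φ⟫ dτ`
  (`integral_inner_oseenDuhamel_eq_neg_intervalIntegral`), **weak divergence freeness** of every
  slice (`isWeaklyDivFree_oseenDuhamel`, from the divergence freeness of the kernel) and slice
  measurability — the bounded-field twins of the Koch–Tataru-class statements of
  `KochTataruPairing.lean` / `KochTataruPointwise.lean`.
* `§ Heat`: the free term of a **bounded** weakly divergence-free datum: symmetry of the caloric
  pairing (`integral_inner_heatExtension_comm_of_bound`), the gradient through the heat flow of a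
  test function, and `e^{rΔ}u₀` weakly divergence free (`IsWeaklyDivFree.heatExtension_of_bound`,
  through the tree's `IsWeaklyDivFree.integral_inner_gradient_eq_zero` for the integrable
  non-compactly supported test `e^{rΔ}θ`).
* `§ Drift`, **(A1)** `exists_const_oseenMild_of_bounded_isBesovMildSolutionOn`: under the
  hypotheses of the smoothing fact (a Besov mild solution `(u, U)` on `[0, T)` in the
  Gallagher–Koch–Planchon class with slices essentially bounded on every `(0, T₁)`), for every
  `t ∈ (0, T)` there is a constant vector `c` with
  `u(t) = e^{νtΔ}u(0) - B^ν_0(u,u)(t) - c` a.e.: the datum is bounded by the same constant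
  (`eLpNorm_top_zero_le_of_continuousInHomBesovOn`, `BesovMildBounds.lean`), a bounded
  representative (`exists_bounded_representative`) changes neither term, and the bounded field
  `e^{νtΔ}ū(0) - B^ν_0(ū,ū)(t) - ū(t)` annihilates solenoidal tests (the duality identity at `t`)
  and is weakly divergence free, hence a.e. constant (annihilator lemma in `L^∞`,
  `BoundedAnnihilator.lean`; KNSS 2009, Lemma 3.1 / Rem. 3.1: the drift `b(t)`). The vanishing of
  `c` — (A) proper — is where the realisation clause of the Besov class enters (large-scale decay
  of `Ṡ_j B^ν_0(u,u)(t)`); it is not proved here.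

## References

* G. Koch, N. Nadirashvili, G. Seregin, V. Šverák, Acta Math. 203 (2009) 83–105 =
  arXiv:0709.3599, §3 p. 7 (Lemma 3.1, Rem. 3.1), §4 p. 8 (the bilinear form `B`, its `L^∞`
  bound). [KochNadirashviliSereginSverak2009]
* P. G. Lemarié-Rieusset, *The Navier–Stokes problem in the 21st century*, CRC Press 2016,
  Thm. 6.1 ((6.12) ⇒ (6.11)). [LemarieRieusset2016]
* H. Koch, D. Tataru, Adv. Math. 157 (2001), §2 (5)–(8), §3 (11), (14). [KochTataruAdvMath2001]
-/

noncomputable section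

open MeasureTheory Set Function Filter TopologicalSpace InnerProductSpace Metric
open _root_.Topology
open scoped RealInnerProductSpace NNReal ENNReal SchwartzMap

namespace Literature.Analysis.FluidPDE

variable {E : Type*} [NormedAddCommGroup E] [InnerProductSpace ℝ E] [FiniteDimensional ℝ E]
  [MeasurableSpace E] [BorelSpace E]

/-! ### Absolute convergence of the Oseen Duhamel term of bounded fields -/

section Majorant

omit [InnerProductSpace ℝ E] [FiniteDimensional ℝ E] [MeasurableSpace E] [BorelSpace E] in
/-- `∫_{(s,t)} (t - τ)^{-1/2} dτ = 2 √(t - s)` as a set `∫⁻` (reflection `τ ↦ t - τ`). [folklore] -/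
theorem setLIntegral_Ioo_sub_rpow_neg_half_of_lt {s t : ℝ} (hst : s < t) :
    ∫⁻ τ in Ioo s t, ENNReal.ofReal ((t - τ) ^ (-(1 / 2 : ℝ))) =
      ENNReal.ofReal (2 * Real.sqrt (t - s)) := by
  have hmp : MeasurePreserving (fun τ : ℝ => t - τ) volume volume :=
    Measure.measurePreserving_sub_left volume t
  have hemb : MeasurableEmbedding (fun τ : ℝ => t - τ) :=
    (MeasurableEquiv.subLeft t).measurableEmbedding
  have h := hmp.setLIntegral_comp_preimage_emb hemb
    (fun σ => ENNReal.ofReal (σ ^ (-(1 / 2 : ℝ)))) (Ioo 0 (t - s))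
  rw [preimage_const_sub_Ioo, sub_zero, sub_sub_cancel] at h
  rw [h, setLIntegral_Ioo_rpow_neg_half (sub_pos.2 hst)]

/-- **Majorant of the Oseen Duhamel integrand of bounded fields** (Koch–Nadirashvili–Seregin–Šverák
2009, §4 p. 8: `‖B(u,v)‖_{L^∞} ≤ C√T ‖u‖_{L^∞}‖v‖_{L^∞}`, from the kernel bound
`|K_{ijk}(x,t)| ≤ C(|x|² + t)^{-(n+1)/2}` of §3): there is `C = C(E) > 0` such that for fields
`u`, `v` bounded by `M ≥ 0` on `(s, t) × E`, `ν > 0` and every `x`,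
`∫_{(s,t)} ∫ ‖K(ν(t-τ), x-y)[u(τ,y), v(τ,y)]‖ dy dτ ≤ C M² ν^{-1/2} · 2√(t-s)` (iterated
`∫⁻`; no measurability is needed). [cite: KochNadirashviliSereginSverak2009, §4 p. 8 (the bound for B) (arXiv:0709.3599)] -/
theorem exists_lintegral_enorm_oseenKernel_bounded_le :
    ∃ C : ℝ, 0 < C ∧ ∀ {ν : ℝ}, 0 < ν → ∀ {u v : ℝ → E → E} {s t M : ℝ}, s < t → 0 ≤ M →
      (∀ τ ∈ Ioo s t, ∀ y, ‖u τ y‖ ≤ M) → (∀ τ ∈ Ioo s t, ∀ y, ‖v τ y‖ ≤ M) → ∀ x : E,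
        ∫⁻ τ in Ioo s t, ∫⁻ y, ‖oseenKernel (ν * (t - τ)) (x - y) (u τ y) (v τ y)‖ₑ ≤
          ENNReal.ofReal (C * M ^ 2 * ν ^ (-(1 / 2 : ℝ)) * (2 * Real.sqrt (t - s))) := by
  set d : ℝ := (Module.finrank ℝ E : ℝ) with hd
  obtain ⟨C₀, hC₀, hK⟩ := exists_norm_oseenKernel_le (E := E)
  set I : ℝ := ∫ w : E, (1 + ‖w‖ ^ 2) ^ (-((d + 1) / 2)) with hI
  have he : d < 2 * ((d + 1) / 2) := by linarith
  have hI0 : 0 < I := integral_one_add_norm_sq_rpow_neg_pos he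
  refine ⟨C₀ * I, by positivity, fun {ν} hν {u v s t M} hst hM hu hv x => ?_⟩
  have hscal : d / 2 - (d + 1) / 2 = -(1 / 2 : ℝ) := by ring
  -- the slice bound
  have hslice : ∀ τ ∈ Ioo s t,
      ∫⁻ y, ‖oseenKernel (ν * (t - τ)) (x - y) (u τ y) (v τ y)‖ₑ ≤
        ENNReal.ofReal (C₀ * M ^ 2 * I * (ν * (t - τ)) ^ (-(1 / 2 : ℝ))) := by
    intro τ hτ
    have hσ : 0 < ν * (t - τ) := mul_pos hν (sub_pos.2 hτ.2)
    calc ∫⁻ y, ‖oseenKernel (ν * (t - τ)) (x - y) (u τ y) (v τ y)‖ₑ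
        ≤ ∫⁻ y, ENNReal.ofReal (C₀ * M ^ 2) *
            ENNReal.ofReal ((ν * (t - τ) + ‖x - y‖ ^ 2) ^ (-((d + 1) / 2))) := by
          refine lintegral_mono fun y => ?_
          rw [← ofReal_norm, ← ENNReal.ofReal_mul (by positivity)]
          refine ENNReal.ofReal_le_ofReal ?_
          calc ‖oseenKernel (ν * (t - τ)) (x - y) (u τ y) (v τ y)‖
              ≤ C₀ * (ν * (t - τ) + ‖x - y‖ ^ 2) ^ (-((d + 1) / 2)) * ‖u τ y‖ * ‖v τ y‖ :=
                hK hσ (x - y) _ _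
            _ ≤ C₀ * (ν * (t - τ) + ‖x - y‖ ^ 2) ^ (-((d + 1) / 2)) * M * M := by
                gcongr
                · exact hu τ hτ y
                · exact hv τ hτ y
            _ = C₀ * M ^ 2 * (ν * (t - τ) + ‖x - y‖ ^ 2) ^ (-((d + 1) / 2)) := by ring
      _ = ENNReal.ofReal (C₀ * M ^ 2) *
            ∫⁻ y, ENNReal.ofReal ((ν * (t - τ) + ‖x - y‖ ^ 2) ^ (-((d + 1) / 2))) :=
          lintegral_const_mul' _ _ ENNReal.ofReal_ne_top
      _ = ENNReal.ofReal (C₀ * M ^ 2) *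
            ENNReal.ofReal ((ν * (t - τ)) ^ (d / 2 - (d + 1) / 2) * I) := by
          rw [lintegral_weight_sub_left, lintegral_add_norm_sq_rpow_neg he hσ]
      _ = ENNReal.ofReal (C₀ * M ^ 2 * I * (ν * (t - τ)) ^ (-(1 / 2 : ℝ))) := by
          rw [← ENNReal.ofReal_mul (by positivity), hscal]
          ring_nf
  -- integrate in time
  calc ∫⁻ τ in Ioo s t, ∫⁻ y, ‖oseenKernel (ν * (t - τ)) (x - y) (u τ y) (v τ y)‖ₑ
      ≤ ∫⁻ τ in Ioo s t, ENNReal.ofReal (C₀ * M ^ 2 * I * (ν * (t - τ)) ^ (-(1 / 2 : ℝ))) :=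
        setLIntegral_mono' measurableSet_Ioo fun τ hτ => hslice τ hτ
    _ = ∫⁻ τ in Ioo s t, ENNReal.ofReal (C₀ * M ^ 2 * I * ν ^ (-(1 / 2 : ℝ))) *
          ENNReal.ofReal ((t - τ) ^ (-(1 / 2 : ℝ))) := by
        refine setLIntegral_congr_fun measurableSet_Ioo fun τ hτ => ?_
        rw [← ENNReal.ofReal_mul (by positivity),
          Real.mul_rpow hν.le (sub_pos.2 hτ.2).le]
        ring_nf
    _ = ENNReal.ofReal (C₀ * M ^ 2 * I * ν ^ (-(1 / 2 : ℝ))) * ENNReal.ofReal (2 * Real.sqrt (t - s)) := by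
        rw [lintegral_const_mul' _ _ ENNReal.ofReal_ne_top, setLIntegral_Ioo_sub_rpow_neg_half_of_lt hst]
    _ = ENNReal.ofReal (C₀ * I * M ^ 2 * ν ^ (-(1 / 2 : ℝ)) * (2 * Real.sqrt (t - s))) := by
        rw [← ENNReal.ofReal_mul (by positivity)]
        ring_nf

end Majorant

/-! ### The Duhamel term of bounded measurable fields: product form, bounds, measurability -/

section Bounded

variable {ν s T M : ℝ} {u v : ℝ → E → E}

/-- Measurability of the Duhamel integrand `(τ, y) ↦ K(ν(t-τ), x-y)[u(τ,y), v(τ,y)]` on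
`(s, t) × E` for fields measurable on `(s, T) × E`, `t ≤ T`. [folklore] -/
theorem aestronglyMeasurable_oseenKernel_duhamel' (ν : ℝ)
    (hu : AEStronglyMeasurable (uncurry u) ((volume : Measure (ℝ × E)).restrict (Ioo s T ×ˢ univ)))
    (hv : AEStronglyMeasurable (uncurry v) ((volume : Measure (ℝ × E)).restrict (Ioo s T ×ˢ univ)))
    {t : ℝ} (htT : t ≤ T) (x : E) :
    AEStronglyMeasurable
      (fun p : ℝ × E => oseenKernel (ν * (t - p.1)) (x - p.2) (u p.1 p.2) (v p.1 p.2))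
      ((volume : Measure (ℝ × E)).restrict (Ioo s t ×ˢ univ)) := by
  have hsub : Ioo s t ×ˢ (univ : Set E) ⊆ Ioo s T ×ˢ univ :=
    prod_mono (Ioo_subset_Ioo_right htT) subset_rfl
  have hu' : AEMeasurable (fun p : ℝ × E => u p.1 p.2)
      ((volume : Measure (ℝ × E)).restrict (Ioo s t ×ˢ univ)) :=
    (hu.mono_measure (Measure.restrict_mono hsub le_rfl)).aemeasurable
  have hv' : AEMeasurable (fun p : ℝ × E => v p.1 p.2)
      ((volume : Measure (ℝ × E)).restrict (Ioo s t ×ˢ univ)) :=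
    (hv.mono_measure (Measure.restrict_mono hsub le_rfl)).aemeasurable
  exact (AEMeasurable.oseenKernel_comp ((measurable_const.sub measurable_fst).const_mul ν).aemeasurable
    (measurable_const.sub measurable_snd).aemeasurable hu' hv').aestronglyMeasurable

/-- **Absolute convergence of the Duhamel term of bounded fields**: for `u`, `v` measurable on
`(s, T) × E` and bounded by `M` there, `ν > 0`, `s < t ≤ T`, the integrand of
`B^ν_s(u,v)(t)(x)` is integrable on `(s, t) × E` (KNSS 2009, §4 p. 8). [cite: KochNadirashviliSereginSverak2009, §4 p. 8 (the bound for B) (arXiv:0709.3599)] -/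
theorem integrable_oseenKernel_duhamel_bounded (hν : 0 < ν)
    (hu : AEStronglyMeasurable (uncurry u) ((volume : Measure (ℝ × E)).restrict (Ioo s T ×ˢ univ)))
    (hv : AEStronglyMeasurable (uncurry v) ((volume : Measure (ℝ × E)).restrict (Ioo s T ×ˢ univ)))
    (hM : 0 ≤ M) (huM : ∀ τ ∈ Ioo s T, ∀ y, ‖u τ y‖ ≤ M) (hvM : ∀ τ ∈ Ioo s T, ∀ y, ‖v τ y‖ ≤ M)
    {t : ℝ} (hst : s < t) (htT : t ≤ T) (x : E) :
    Integrable (fun p : ℝ × E => oseenKernel (ν * (t - p.1)) (x - p.2) (u p.1 p.2) (v p.1 p.2))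
      ((volume : Measure (ℝ × E)).restrict (Ioo s t ×ˢ univ)) := by
  obtain ⟨C, hC, h⟩ := exists_lintegral_enorm_oseenKernel_bounded_le (E := E)
  refine ⟨aestronglyMeasurable_oseenKernel_duhamel' ν hu hv htT x, ?_⟩
  rw [hasFiniteIntegral_iff_enorm, volume_restrict_prod_univ_eq_prod]
  refine lt_of_le_of_lt ((lintegral_prod_le _).trans (h hν hst hM
    (fun τ hτ => huM τ ⟨hτ.1, hτ.2.trans_le htT⟩) (fun τ hτ => hvM τ ⟨hτ.1, hτ.2.trans_le htT⟩) x))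
    ENNReal.ofReal_lt_top

/-- **The Duhamel term as a product integral**: for bounded measurable fields,
`B^ν_s(u,v)(t)(x) = ∫_{(s,t) × E} K(ν(t-τ), x-y)[u(τ,y), v(τ,y)] d(τ,y)` (Fubini). [folklore] -/
theorem oseenDuhamel_eq_integral_prod (hν : 0 < ν)
    (hu : AEStronglyMeasurable (uncurry u) ((volume : Measure (ℝ × E)).restrict (Ioo s T ×ˢ univ)))
    (hv : AEStronglyMeasurable (uncurry v) ((volume : Measure (ℝ × E)).restrict (Ioo s T ×ˢ univ)))
    (hM : 0 ≤ M) (huM : ∀ τ ∈ Ioo s T, ∀ y, ‖u τ y‖ ≤ M) (hvM : ∀ τ ∈ Ioo s T, ∀ y, ‖v τ y‖ ≤ M)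
    {t : ℝ} (hst : s < t) (htT : t ≤ T) (x : E) :
    oseenDuhamel ν s u v t x =
      ∫ p in Ioo s t ×ˢ univ, oseenKernel (ν * (t - p.1)) (x - p.2) (u p.1 p.2) (v p.1 p.2)
        ∂(volume : Measure (ℝ × E)) := by
  have hint := integrable_oseenKernel_duhamel_bounded hν hu hv hM huM hvM hst htT x
  rw [volume_restrict_prod_univ_eq_prod] at hint ⊢
  rw [oseenDuhamel, integral_prod _ hint]

/-- **The `L^∞` bound for the Duhamel term of bounded fields** (KNSS 2009, §4 p. 8:
`‖B(u,v)‖_{L^∞} ≤ C√T‖u‖‖v‖`): with the constant of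
`exists_lintegral_enorm_oseenKernel_bounded_le`,
`‖B^ν_s(u,v)(t)(x)‖ ≤ C M² ν^{-1/2} 2√(t-s)`. [cite: KochNadirashviliSereginSverak2009, §4 p. 8 (the bound for B) (arXiv:0709.3599)] -/
theorem exists_norm_oseenDuhamel_bounded_le :
    ∃ C : ℝ, 0 < C ∧ ∀ {ν : ℝ}, 0 < ν → ∀ {u v : ℝ → E → E} {s t M : ℝ}, s < t → 0 ≤ M →
      (∀ τ ∈ Ioo s t, ∀ y, ‖u τ y‖ ≤ M) → (∀ τ ∈ Ioo s t, ∀ y, ‖v τ y‖ ≤ M) → ∀ x : E,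
        ‖oseenDuhamel ν s u v t x‖ ≤ C * M ^ 2 * ν ^ (-(1 / 2 : ℝ)) * (2 * Real.sqrt (t - s)) := by
  obtain ⟨C, hC, h⟩ := exists_lintegral_enorm_oseenKernel_bounded_le (E := E)
  refine ⟨C, hC, fun {ν} hν {u v s t M} hst hM hu hv x => ?_⟩
  set F : ℝ × E → E := fun p => oseenKernel (ν * (t - p.1)) (x - p.2) (u p.1 p.2) (v p.1 p.2) with hF
  have hnn : 0 ≤ C * M ^ 2 * ν ^ (-(1 / 2 : ℝ)) * (2 * Real.sqrt (t - s)) := by positivity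
  rw [← ENNReal.ofReal_le_ofReal_iff hnn, ofReal_norm]
  calc ‖oseenDuhamel ν s u v t x‖ₑ
      ≤ ∫⁻ τ in Ioo s t, ‖∫ y, F (τ, y)‖ₑ := enorm_integral_le_lintegral_enorm _
    _ ≤ ∫⁻ τ in Ioo s t, ∫⁻ y, ‖F (τ, y)‖ₑ :=
        lintegral_mono fun τ => enorm_integral_le_lintegral_enorm _
    _ ≤ _ := h hν hst hM hu hv x

/-- **The Duhamel term of bounded fields against a test field is the space–time integral of the
tested kernel** (Fubini over `E × ((s,t) × E)` under the majorant
`∫ |w| ∫∫ |K| ≤ ‖w‖₁ C M² ν^{-1/2} 2√(t-s)`): for a continuous compactly supported `w`,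
`∫ ⟪B^ν_s(u,v)(t), w⟫ = ∫_{(s,t)×E} (∫ ⟪K(ν(t-τ), x-y)[u(τ,y), v(τ,y)], w(x)⟫ dx) d(τ,y)`. [folklore] -/
theorem integral_inner_oseenDuhamel_eq_setIntegral (hν : 0 < ν)
    (hu : AEStronglyMeasurable (uncurry u) ((volume : Measure (ℝ × E)).restrict (Ioo s T ×ˢ univ)))
    (hv : AEStronglyMeasurable (uncurry v) ((volume : Measure (ℝ × E)).restrict (Ioo s T ×ˢ univ)))
    (hM : 0 ≤ M) (huM : ∀ τ ∈ Ioo s T, ∀ y, ‖u τ y‖ ≤ M) (hvM : ∀ τ ∈ Ioo s T, ∀ y, ‖v τ y‖ ≤ M)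
    {t : ℝ} (hst : s < t) (htT : t ≤ T) {w : E → E} (hw : Continuous w) (hwc : HasCompactSupport w) :
    Integrable (uncurry fun (x : E) (p : ℝ × E) =>
        ⟪oseenKernel (ν * (t - p.1)) (x - p.2) (u p.1 p.2) (v p.1 p.2), w x⟫)
        ((volume : Measure E).prod ((volume : Measure (ℝ × E)).restrict (Ioo s t ×ˢ univ))) ∧
      ∫ x, ⟪oseenDuhamel ν s u v t x, w x⟫ =
        ∫ p in Ioo s t ×ˢ univ,
          (∫ x, ⟪oseenKernel (ν * (t - p.1)) (x - p.2) (u p.1 p.2) (v p.1 p.2), w x⟫)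
          ∂(volume : Measure (ℝ × E)) := by
  set μ : Measure (ℝ × E) := (volume : Measure (ℝ × E)).restrict (Ioo s t ×ˢ univ) with hμ
  set F : E → ℝ × E → E := fun x p =>
    oseenKernel (ν * (t - p.1)) (x - p.2) (u p.1 p.2) (v p.1 p.2) with hF
  have huM' : ∀ τ ∈ Ioo s t, ∀ y, ‖u τ y‖ ≤ M := fun τ hτ => huM τ ⟨hτ.1, hτ.2.trans_le htT⟩
  have hvM' : ∀ τ ∈ Ioo s t, ∀ y, ‖v τ y‖ ≤ M := fun τ hτ => hvM τ ⟨hτ.1, hτ.2.trans_le htT⟩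
  -- measurability of the integrand on `E × ((s,t) × E)`
  have hsub : Ioo s t ×ˢ (univ : Set E) ⊆ Ioo s T ×ˢ univ := prod_mono (Ioo_subset_Ioo_right htT) subset_rfl
  have hu' : AEStronglyMeasurable (fun p : ℝ × E => u p.1 p.2) μ :=
    hu.mono_measure (Measure.restrict_mono hsub le_rfl)
  have hv' : AEStronglyMeasurable (fun p : ℝ × E => v p.1 p.2) μ :=
    hv.mono_measure (Measure.restrict_mono hsub le_rfl)
  have hKm : AEMeasurable (fun q : E × (ℝ × E) => F q.1 q.2) ((volume : Measure E).prod μ) := by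
    refine AEMeasurable.oseenKernel_comp ?_ ?_ ?_ ?_
    · exact ((measurable_const.sub measurable_snd.fst).const_mul ν).aemeasurable
    · exact (measurable_fst.sub measurable_snd.snd).aemeasurable
    · exact (hu'.comp_snd (μ := (volume : Measure E))).aemeasurable
    · exact (hv'.comp_snd (μ := (volume : Measure E))).aemeasurable
  have hFm : AEStronglyMeasurable (uncurry fun x p => ⟪F x p, w x⟫) ((volume : Measure E).prod μ) :=
    (hKm.inner (hw.measurable.comp measurable_fst).aemeasurable).aestronglyMeasurable
  -- integrability on the product, by Tonelli and the majorant bound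
  obtain ⟨C, hC, hmaj⟩ := exists_lintegral_enorm_oseenKernel_bounded_le (E := E)
  set B : ℝ≥0∞ := ENNReal.ofReal (C * M ^ 2 * ν ^ (-(1 / 2 : ℝ)) * (2 * Real.sqrt (t - s))) with hB
  have hprod : Integrable (uncurry fun x p => ⟪F x p, w x⟫) ((volume : Measure E).prod μ) := by
    refine ⟨hFm, ?_⟩
    rw [hasFiniteIntegral_iff_enorm, lintegral_prod _ hFm.enorm]
    have hwi : ∫⁻ x, ‖w x‖ₑ ∂(volume : Measure E) < ∞ := (hw.integrable_of_hasCompactSupport hwc).2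
    calc ∫⁻ x, ∫⁻ p, ‖uncurry (fun x p => ⟪F x p, w x⟫) (x, p)‖ₑ ∂μ
        ≤ ∫⁻ x, ∫⁻ p, ‖F x p‖ₑ * ‖w x‖ₑ ∂μ := by
          refine lintegral_mono fun x => lintegral_mono fun p => ?_
          simp only [uncurry_apply_pair]
          rw [← ofReal_norm, ← ofReal_norm, ← ofReal_norm, ← ENNReal.ofReal_mul (norm_nonneg _)]
          refine ENNReal.ofReal_le_ofReal ?_
          rw [Real.norm_eq_abs]
          exact abs_real_inner_le_norm _ _
      _ = ∫⁻ x, (∫⁻ p, ‖F x p‖ₑ ∂μ) * ‖w x‖ₑ := by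
          refine lintegral_congr fun x => ?_
          rw [lintegral_mul_const' _ _ enorm_ne_top]
      _ ≤ ∫⁻ x, B * ‖w x‖ₑ := by
          refine lintegral_mono fun x => ?_
          gcongr
          rw [hμ, volume_restrict_prod_univ_eq_prod]
          exact (lintegral_prod_le _).trans (hmaj hν hst hM huM' hvM' x)
      _ = B * ∫⁻ x, ‖w x‖ₑ := lintegral_const_mul' _ _ ENNReal.ofReal_ne_top
      _ < ∞ := ENNReal.mul_lt_top ENNReal.ofReal_lt_top hwi
  refine ⟨hprod, ?_⟩
  -- the inner product through the integral, then Fubini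
  have hinner : ∀ x, ⟪oseenDuhamel ν s u v t x, w x⟫ = ∫ p, ⟪F x p, w x⟫ ∂μ := by
    intro x
    have hint := integrable_oseenKernel_duhamel_bounded hν hu hv hM huM hvM hst htT x
    rw [oseenDuhamel_eq_integral_prod hν hu hv hM huM hvM hst htT x, real_inner_comm,
      ← integral_inner hint (w x)]
    exact integral_congr_ae (Eventually.of_forall fun p => real_inner_comm _ _)
  calc ∫ x, ⟪oseenDuhamel ν s u v t x, w x⟫ = ∫ x, ∫ p, ⟪F x p, w x⟫ ∂μ :=
        integral_congr_ae (Eventually.of_forall hinner)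
    _ = ∫ p, (∫ x, ⟪F x p, w x⟫) ∂μ := integral_integral_swap hprod

/-- **The Duhamel term of bounded fields tested against a divergence-free field**
(Lemarié-Rieusset 2016, Thm. 6.1, (6.12) ⇒ (6.11); the adjoint identity
`integral_inner_oseenKernel_comp_sub_of_isDivFree` inside the space–time integral): for
`φ ∈ C_c^∞` with `div φ = 0`,
`∫ ⟪B^ν_s(u,v)(t), φ⟫ = -∫_s^t ∫ ⟪v(τ,y), D(e^{ν(t-τ)Δ}φ)(y) u(τ,y)⟫ dy dτ`, the iterated
integral being absolutely convergent. [cite: LemarieRieusset2016, Thm. 6.1 ((6.12) ⇒ (6.11))] -/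
theorem integral_inner_oseenDuhamel_of_isDivFree (hν : 0 < ν)
    (hu : AEStronglyMeasurable (uncurry u) ((volume : Measure (ℝ × E)).restrict (Ioo s T ×ˢ univ)))
    (hv : AEStronglyMeasurable (uncurry v) ((volume : Measure (ℝ × E)).restrict (Ioo s T ×ˢ univ)))
    (hM : 0 ≤ M) (huM : ∀ τ ∈ Ioo s T, ∀ y, ‖u τ y‖ ≤ M) (hvM : ∀ τ ∈ Ioo s T, ∀ y, ‖v τ y‖ ≤ M)
    {t : ℝ} (hst : s < t) (htT : t ≤ T)
    {φ : E → E} (hφ : FunctionSpaces.IsTestFunctionOn (⊤ : Opens E) φ) (hdiv : VectorCalculus.IsDivFree φ) :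
    Integrable (fun p : ℝ × E =>
        ⟪v p.1 p.2, fderiv ℝ (UnboundedOperators.heatExtension φ (ν * (t - p.1))) p.2 (u p.1 p.2)⟫)
        ((volume : Measure (ℝ × E)).restrict (Ioo s t ×ˢ univ)) ∧
      ∫ x, ⟪oseenDuhamel ν s u v t x, φ x⟫ =
        -∫ τ in Ioo s t, ∫ y,
          ⟪v τ y, fderiv ℝ (UnboundedOperators.heatExtension φ (ν * (t - τ))) y (u τ y)⟫ := by
  set μ : Measure (ℝ × E) := (volume : Measure (ℝ × E)).restrict (Ioo s t ×ˢ univ) with hμ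
  set g : ℝ × E → ℝ := fun p =>
    ⟪v p.1 p.2, fderiv ℝ (UnboundedOperators.heatExtension φ (ν * (t - p.1))) p.2 (u p.1 p.2)⟫ with hg
  obtain ⟨hprod, heq⟩ := integral_inner_oseenDuhamel_eq_setIntegral hν hu hv hM huM hvM hst htT
    hφ.contDiff.continuous hφ.hasCompactSupport
  -- the tested kernel on `(s,t) × E` is `-g`
  have hK : ∀ p ∈ Ioo s t ×ˢ (univ : Set E),
      ∫ x, ⟪oseenKernel (ν * (t - p.1)) (x - p.2) (u p.1 p.2) (v p.1 p.2), φ x⟫ = -g p := by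
    intro p hp
    rw [mem_prod] at hp
    exact integral_inner_oseenKernel_comp_sub_of_isDivFree (mul_pos hν (sub_pos.2 hp.1.2)) p.2 _ _
      hφ hdiv
  have hgi : Integrable g μ := by
    have hneg := (hprod.integral_prod_right).neg
    refine hneg.congr ?_
    filter_upwards [ae_restrict_mem (measurableSet_Ioo.prod MeasurableSet.univ)] with p hp
    simp only [uncurry, Pi.neg_apply]
    rw [hK p hp, neg_neg]
  refine ⟨hgi, ?_⟩
  rw [heq, setIntegral_congr_fun (measurableSet_Ioo.prod MeasurableSet.univ) hK, integral_neg]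
  congr 1
  have hgi' : Integrable g (((volume : Measure ℝ).restrict (Ioo s t)).prod (volume : Measure E)) := by
    rwa [hμ, volume_restrict_prod_univ_eq_prod] at hgi
  rw [volume_restrict_prod_univ_eq_prod, integral_prod _ hgi']

/-- **The Duhamel term of a bounded field in the duality form of the tree** (the nonlinear term of
`Fluid.IsMildNSSolutionFrom ν 0 u₀ u t` from the initial time `s`): for a divergence-free test
field `φ` and `s < t ≤ T`,
`∫ ⟪B^ν_s(u,u)(t), φ⟫ = -∫ₛᵗ ∫ ⟪u(τ), (u(τ)·∇) e^{ν(t-τ)Δ}φ⟫ dτ`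
(Lemarié-Rieusset 2016, Thm. 6.1, (6.12) ⇒ (6.11)). [cite: LemarieRieusset2016, Thm. 6.1 ((6.12) ⇒ (6.11))] -/
theorem integral_inner_oseenDuhamel_eq_neg_intervalIntegral (hν : 0 < ν)
    (hu : AEStronglyMeasurable (uncurry u) ((volume : Measure (ℝ × E)).restrict (Ioo s T ×ˢ univ)))
    (hM : 0 ≤ M) (huM : ∀ τ ∈ Ioo s T, ∀ y, ‖u τ y‖ ≤ M) {t : ℝ} (hst : s < t) (htT : t ≤ T)
    {φ : E → E} (hφ : FunctionSpaces.IsTestFunctionOn (⊤ : Opens E) φ) (hdiv : VectorCalculus.IsDivFree φ) :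
    ∫ x, ⟪oseenDuhamel ν s u u t x, φ x⟫ =
      -∫ τ in s..t, ∫ y, ⟪u τ y, convect (u τ) (heatTest ν φ (t - τ)) y⟫ := by
  rw [(integral_inner_oseenDuhamel_of_isDivFree hν hu hu hM huM huM hst htT hφ hdiv).2,
    intervalIntegral.integral_of_le hst.le, integral_Ioc_eq_integral_Ioo]
  congr 1
  refine setIntegral_congr_fun measurableSet_Ioo fun τ hτ => ?_
  have hpos : 0 < t - τ := sub_pos.2 hτ.2
  simp only [convect_apply, heatTest_of_pos hν hpos]

/-- **The Duhamel term of bounded fields is weakly divergence free** at every time `t ∈ (s, T]`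
(the kernel of `e^{σΔ}P∇·` is divergence free in `z`: `integral_inner_oseenKernel_comp_sub_gradient`
inside the space–time integral; Koch–Tataru 2001, §2 (5)–(8)). [cite: KochTataruAdvMath2001, §2 (5)–(8)] -/
theorem isWeaklyDivFree_oseenDuhamel (hν : 0 < ν)
    (hu : AEStronglyMeasurable (uncurry u) ((volume : Measure (ℝ × E)).restrict (Ioo s T ×ˢ univ)))
    (hv : AEStronglyMeasurable (uncurry v) ((volume : Measure (ℝ × E)).restrict (Ioo s T ×ˢ univ)))
    (hM : 0 ≤ M) (huM : ∀ τ ∈ Ioo s T, ∀ y, ‖u τ y‖ ≤ M) (hvM : ∀ τ ∈ Ioo s T, ∀ y, ‖v τ y‖ ≤ M)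
    {t : ℝ} (hst : s < t) (htT : t ≤ T) :
    IsWeaklyDivFree (oseenDuhamel ν s u v t) := by
  haveI : CompleteSpace E := FiniteDimensional.complete ℝ E
  intro θ hθ
  have hθ1 : ContDiff ℝ 1 θ := hθ.contDiff.of_le (by exact_mod_cast le_top)
  have hgc : Continuous (gradient θ) := continuous_gradient_of_contDiff hθ1
  have hgs : HasCompactSupport (gradient θ) :=
    (hθ.hasCompactSupport.fderiv (𝕜 := ℝ)).comp_left (g := (InnerProductSpace.toDual ℝ E).symm)
      (map_zero _)
  rw [(integral_inner_oseenDuhamel_eq_setIntegral hν hu hv hM huM hvM hst htT hgc hgs).2,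
    setIntegral_congr_fun (measurableSet_Ioo.prod MeasurableSet.univ) (g := fun _ => 0)
      (fun p hp => ?_)]
  · simp
  · rw [mem_prod] at hp
    exact integral_inner_oseenKernel_comp_sub_gradient (mul_pos hν (sub_pos.2 hp.1.2)) p.2 _ _ hθ

/-- **Slices of the Duhamel term of bounded fields are a.e. strongly measurable** (the product
form `B(t)(x) = ∫ F(x, p) dp` with a jointly measurable integrand,
`AEStronglyMeasurable.integral_prod_right'`). [folklore] -/
theorem aestronglyMeasurable_oseenDuhamel (hν : 0 < ν)
    (hu : AEStronglyMeasurable (uncurry u) ((volume : Measure (ℝ × E)).restrict (Ioo s T ×ˢ univ)))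
    (hv : AEStronglyMeasurable (uncurry v) ((volume : Measure (ℝ × E)).restrict (Ioo s T ×ˢ univ)))
    (hM : 0 ≤ M) (huM : ∀ τ ∈ Ioo s T, ∀ y, ‖u τ y‖ ≤ M) (hvM : ∀ τ ∈ Ioo s T, ∀ y, ‖v τ y‖ ≤ M)
    {t : ℝ} (hst : s < t) (htT : t ≤ T) :
    AEStronglyMeasurable (oseenDuhamel ν s u v t) (volume : Measure E) := by
  set μ : Measure (ℝ × E) := (volume : Measure (ℝ × E)).restrict (Ioo s t ×ˢ univ) with hμ
  haveI : SFinite μ := by rw [hμ]; infer_instance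
  have hsub : Ioo s t ×ˢ (univ : Set E) ⊆ Ioo s T ×ˢ univ := prod_mono (Ioo_subset_Ioo_right htT) subset_rfl
  have hu' : AEStronglyMeasurable (fun p : ℝ × E => u p.1 p.2) μ :=
    hu.mono_measure (Measure.restrict_mono hsub le_rfl)
  have hv' : AEStronglyMeasurable (fun p : ℝ × E => v p.1 p.2) μ :=
    hv.mono_measure (Measure.restrict_mono hsub le_rfl)
  have hKm : AEStronglyMeasurable (uncurry fun (x : E) (p : ℝ × E) =>
      oseenKernel (ν * (t - p.1)) (x - p.2) (u p.1 p.2) (v p.1 p.2)) ((volume : Measure E).prod μ) := by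
    refine (AEMeasurable.oseenKernel_comp ?_ ?_ ?_ ?_).aestronglyMeasurable
    · exact ((measurable_const.sub measurable_snd.fst).const_mul ν).aemeasurable
    · exact (measurable_fst.sub measurable_snd.snd).aemeasurable
    · exact (hu'.comp_snd (μ := (volume : Measure E))).aemeasurable
    · exact (hv'.comp_snd (μ := (volume : Measure E))).aemeasurable
  have h := hKm.integral_prod_right'
  refine h.congr (Eventually.of_forall fun x => ?_)
  rw [oseenDuhamel_eq_integral_prod hν hu hv hM huM hvM hst htT x]
  rfl

end Bounded

/-! ### The free term: the caloric extension of a bounded weakly divergence-free datum -/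

section Heat

variable {u₀ : E → E} {M : ℝ}

/-- **Symmetry of the caloric pairing for a bounded datum and a test field**:
`∫ ⟪e^{rΔ}u₀, w⟫ = ∫ ⟪u₀, e^{rΔ}w⟫` for `u₀` bounded measurable and `w` continuous of compact
support (`L^∞`–`L¹` case of `integral_inner_heatExtension_comm`; evenness of `G_r`, Fubini). [folklore] -/
theorem integral_inner_heatExtension_comm_of_bound (hu₀ : AEStronglyMeasurable u₀ volume)
    (hM : ∀ x, ‖u₀ x‖ ≤ M) {w : E → E} (hw : Continuous w) (hwc : HasCompactSupport w)
    {r : ℝ} (hr : 0 < r) :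
    ∫ x, ⟪UnboundedOperators.heatExtension u₀ r x, w x⟫ =
      ∫ x, ⟪u₀ x, UnboundedOperators.heatExtension w r x⟫ := by
  have hf : MemLp u₀ ∞ (volume : Measure E) := memLp_top_of_bound hu₀ M (Eventually.of_forall hM)
  have hg : MemLp w 1 (volume : Measure E) :=
    memLp_one_iff_integrable.2 (hw.integrable_of_hasCompactSupport hwc)
  exact (integral_inner_heatExtension_comm (p := ∞) (q := 1) hf hg hr).symm

/-- **The caloric extension of a test function has the caloric extension of its gradient as
gradient**: `∇(e^{rΔ}θ)(x) = e^{rΔ}(∇θ)(x)` (derivatives fall on compactly supported data,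
`fderiv_heatExtension_apply_of_hasCompactSupport`, through the Riesz isomorphism). [folklore] -/
theorem gradient_heatExtension_of_isTestFunctionOn {θ : E → ℝ}
    (hθ : FunctionSpaces.IsTestFunctionOn (⊤ : Opens E) θ) (r : ℝ) (x : E) :
    gradient (UnboundedOperators.heatExtension θ r) x =
      UnboundedOperators.heatExtension (gradient θ) r x := by
  haveI : CompleteSpace E := FiniteDimensional.complete ℝ E
  have hθ1 : ContDiff ℝ 1 θ := hθ.contDiff.of_le (by exact_mod_cast le_top)
  have hgc : Continuous (gradient θ) := continuous_gradient_of_contDiff hθ1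
  have hgs : HasCompactSupport (gradient θ) :=
    (hθ.hasCompactSupport.fderiv (𝕜 := ℝ)).comp_left (g := (InnerProductSpace.toDual ℝ E).symm)
      (map_zero _)
  refine ext_inner_left ℝ fun v => ?_
  rw [inner_gradient_eq_fderiv_apply,
    UnboundedOperators.fderiv_heatExtension_apply_of_hasCompactSupport hθ1 hθ.hasCompactSupport r x v,
    UnboundedOperators.heatExtension_apply, UnboundedOperators.heatExtension_apply,
    ← integral_inner (UnboundedOperators.integrable_heatKernel_smul_comp_sub hgc hgs r x) v]
  refine integral_congr_ae (Eventually.of_forall fun y => ?_)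
  show UnboundedOperators.heatKernel r y • fderiv ℝ θ (x - y) v =
    ⟪v, UnboundedOperators.heatKernel r y • gradient θ (x - y)⟫
  rw [real_inner_smul_right, inner_gradient_eq_fderiv_apply, smul_eq_mul]

/-- **The caloric extension of a bounded weakly divergence-free datum is weakly divergence
free**: `∫ ⟪e^{rΔ}u₀, ∇θ⟫ = ∫ ⟪u₀, ∇(e^{rΔ}θ)⟫ = 0` — the symmetry of the caloric pairing, the
gradient through the heat flow, and the weak divergence constraint tested with the smooth,
integrable, non-compactly supported `e^{rΔ}θ` (`IsWeaklyDivFree.integral_inner_gradient_eq_zero`,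
whose integrability hypotheses hold for bounded `u₀`). [folklore] -/
theorem IsWeaklyDivFree.heatExtension_of_bound (hdiv : IsWeaklyDivFree u₀)
    (hu₀ : AEStronglyMeasurable u₀ volume) (hM : ∀ x, ‖u₀ x‖ ≤ M) {r : ℝ} (hr : 0 < r) :
    IsWeaklyDivFree (UnboundedOperators.heatExtension u₀ r) := by
  haveI : CompleteSpace E := FiniteDimensional.complete ℝ E
  intro θ hθ
  have hθ1 : ContDiff ℝ 1 θ := hθ.contDiff.of_le (by exact_mod_cast le_top)
  have hgc : Continuous (gradient θ) := continuous_gradient_of_contDiff hθ1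
  have hgs : HasCompactSupport (gradient θ) :=
    (hθ.hasCompactSupport.fderiv (𝕜 := ℝ)).comp_left (g := (InnerProductSpace.toDual ℝ E).symm)
      (map_zero _)
  rw [integral_inner_heatExtension_comm_of_bound hu₀ hM hgc hgs hr]
  set Θ : E → ℝ := UnboundedOperators.heatExtension θ r with hΘ
  have hgrad : ∀ x, UnboundedOperators.heatExtension (gradient θ) r x = gradient Θ x := fun x =>
    (gradient_heatExtension_of_isTestFunctionOn hθ r x).symm
  simp_rw [hgrad]
  -- the smooth, integrable test `Θ = e^{rΔ}θ`
  have hΘs : ContDiff ℝ ((⊤ : ℕ∞) : WithTop ℕ∞) Θ :=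
    UnboundedOperators.contDiff_heatExtension_of_hasCompactSupport (n := ⊤) hθ.contDiff
      hθ.hasCompactSupport r
  have hΘi : Integrable Θ :=
    UnboundedOperators.integrable_heatExtension
      (hθ.contDiff.continuous.integrable_of_hasCompactSupport hθ.hasCompactSupport) hr
  have hGi : Integrable (gradient Θ) := by
    have h := UnboundedOperators.integrable_heatExtension (hgc.integrable_of_hasCompactSupport hgs) hr
    exact h.congr (Eventually.of_forall hgrad)
  have hM0 : 0 ≤ M := (norm_nonneg _).trans (hM 0)
  refine hdiv.integral_inner_gradient_eq_zero hu₀ hΘs ?_ ?_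
  · -- `x ↦ DΘ(x)(u₀ x) = ⟪u₀ x, ∇Θ x⟫` is integrable: bounded times integrable
    have hmeas : AEStronglyMeasurable (fun x => fderiv ℝ Θ x (u₀ x)) volume := by
      have h1 : Continuous (fderiv ℝ Θ) := hΘs.continuous_fderiv (by simp)
      have happ := (isBoundedBilinearMap_apply (𝕜 := ℝ) (E := E) (F := ℝ)).continuous
      exact happ.comp_aestronglyMeasurable ((h1.aestronglyMeasurable (μ := volume)).prodMk hu₀)
    refine (hGi.norm.const_mul M).mono' hmeas (Eventually.of_forall fun x => ?_)
    rw [← inner_gradient_eq_fderiv_apply, mul_comm]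
    exact (abs_real_inner_le_norm _ _).trans (mul_le_mul_of_nonneg_right (hM x) (norm_nonneg _)) |>.trans
      (le_of_eq (by ring))
  · refine (hΘi.norm.mul_const M).mono' (hΘs.continuous.aestronglyMeasurable.smul hu₀)
      (Eventually.of_forall fun x => ?_)
    rw [norm_smul]
    exact mul_le_mul_of_nonneg_left (hM x) (norm_nonneg _)

end Heat

/-! ### (A1): bounded Besov mild solutions solve the integral equation up to a constant -/

section Drift

/-- The Duhamel term only sees the a.e. classes of the slices of its arguments. [folklore] -/
theorem oseenDuhamel_congr_ae_slice {ν s t : ℝ} {u u' v v' : ℝ → E → E}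
    (hu : ∀ τ ∈ Ioo s t, u τ =ᵐ[volume] u' τ) (hv : ∀ τ ∈ Ioo s t, v τ =ᵐ[volume] v' τ) (x : E) :
    oseenDuhamel ν s u v t x = oseenDuhamel ν s u' v' t x := by
  unfold oseenDuhamel
  refine setIntegral_congr_fun measurableSet_Ioo fun τ hτ => integral_congr_ae ?_
  filter_upwards [hu τ hτ, hv τ hτ] with y hy hy'
  rw [hy, hy']

/-- **(A1) Bounded Besov mild solutions solve the Oseen integral equation up to a constant drift.**
Under the hypotheses of `knss_classical_of_bounded_isBesovMildSolutionOn` (equivalently of the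
named fact (A) `oseenMild_of_bounded_isBesovMildSolutionOn`), for every `t ∈ (0, T)` there is a
constant vector `c` with `u(t) = e^{νtΔ}u(0) - B^ν_0(u,u)(t) - c` a.e. Proof: the datum is bounded
(`eLpNorm_top_zero_le_of_continuousInHomBesovOn`); pass to a bounded representative `ū`
(`exists_bounded_representative`), which changes neither `e^{νtΔ}u(0)` nor `B^ν_0(u,u)(t)`; the
bounded field `w = e^{νtΔ}ū(0) - B^ν_0(ū,ū)(t) - ū(t)` annihilates every divergence-free test field
(the duality identity of the mild class at `t`, the symmetry of the caloric pairing and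
`integral_inner_oseenDuhamel_eq_neg_intervalIntegral`) and is weakly divergence free
(`IsWeaklyDivFree.heatExtension_of_bound`, `isWeaklyDivFree_oseenDuhamel`), hence is a.e. a
constant by the annihilator lemma in `L^∞` (`BoundedAnnihilator.lean`; Koch–Nadirashvili–Seregin–
Šverák 2009, Lemma 3.1: "bounded solutions of `curl z = 0`, `div z = 0` are constant"). The
vanishing of `c` — the content of (A) proper — is where the realisation clause of the Besov class
enters and is not proved here. [cite: KochNadirashviliSereginSverak2009, Lemma 3.1 and Rem. 3.1 (arXiv:0709.3599 p. 7)] -/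
theorem exists_const_oseenMild_of_bounded_isBesovMildSolutionOn {ν T : ℝ} (hν : 0 < ν) (hT : 0 < T)
    {p q : ℝ≥0∞} [Fact (1 ≤ p)] (hp₃ : 3 < p) (hp : p < ∞) (hq₁ : 1 ≤ q) (_hq : q < ∞)
    {u : ℝ → EuclideanSpace ℝ (Fin 3) → EuclideanSpace ℝ (Fin 3)} {U : ℝ → 𝓢'(EuclideanSpace ℝ (Fin 3), EuclideanSpace ℂ (Fin 3))}
    (hB : IsBesovMildSolutionOn (-1 + 3 / p.toReal) p q T ν u U)
    (hbd : ∀ T₁ ∈ Ioo 0 T, ∃ C : ℝ≥0∞, C < ∞ ∧ ∀ t ∈ Ioo 0 T₁, eLpNorm (u t) ∞ volume ≤ C)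
    {t : ℝ} (ht : t ∈ Ioo 0 T) :
    ∃ c : EuclideanSpace ℝ (Fin 3), u t =ᵐ[volume] fun x =>
      UnboundedOperators.heatExtension (u 0) (ν * t) x - oseenDuhamel ν 0 u u t x - c := by
  -- bounds on `[0, T₁)`, `T₁ = (t + T)/2`
  set T₁ : ℝ := (t + T) / 2 with hT₁
  have htT₁ : t < T₁ := by rw [hT₁]; linarith [ht.2]
  have hT₁T : T₁ < T := by rw [hT₁]; linarith [ht.2]
  have hT₁0 : 0 < T₁ := ht.1.trans htT₁
  obtain ⟨C, hC, hCb⟩ := hbd T₁ ⟨hT₁0, hT₁T⟩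
  have hs := gkp_index_mem_Ioo hp₃ hp
  have h0 : eLpNorm (u 0) ∞ volume ≤ C :=
    eLpNorm_top_zero_le_of_continuousInHomBesovOn hs.2 (by linarith [hs.1]) hq₁ hT₁0 hT₁T.le
      hB.continuousInHomBesovOn hB.isDistributionOf hC hCb
  set M : ℝ := C.toReal + 1 with hM
  have hM0 : 0 < M := by rw [hM]; positivity
  have hCM : C ≤ ENNReal.ofReal M :=
    calc C = ENNReal.ofReal C.toReal := (ENNReal.ofReal_toReal hC.ne).symm
      _ ≤ ENNReal.ofReal M := ENNReal.ofReal_le_ofReal (by rw [hM]; linarith)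
  have hu_Ico : ∀ τ ∈ Ico 0 T₁, eLpNorm (u τ) ∞ volume ≤ ENNReal.ofReal M := by
    intro τ hτ
    rcases hτ.1.eq_or_lt with h | h
    · rw [← h]; exact h0.trans hCM
    · exact (hCb τ ⟨h, hτ.2⟩).trans hCM
  have hsl : ∀ τ ∈ Ico 0 T₁, AEStronglyMeasurable (u τ) volume := fun τ hτ =>
    (hB.isDistributionOf τ ⟨hτ.1, hτ.2.trans hT₁T⟩).aestronglyMeasurable
  have hmeasT₁ : AEStronglyMeasurable (uncurry u)
      ((volume : Measure (ℝ × EuclideanSpace ℝ (Fin 3))).restrict (Ioo 0 T₁ ×ˢ univ)) :=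
    hB.aestronglyMeasurable.mono_measure
      (Measure.restrict_mono (prod_mono (Ioo_subset_Ioo_right hT₁T.le) Subset.rfl) le_rfl)
  -- the bounded representative
  obtain ⟨w, hwu, hwM, hwsl, hwmeas⟩ := exists_bounded_representative hM0 hu_Ico hsl hmeasT₁
  have hwM' : ∀ τ ∈ Ioo 0 T₁, ∀ y, ‖w τ y‖ ≤ M := fun τ _ y => hwM τ y
  -- the representative changes neither the free term nor the Duhamel term
  have hh_eq : UnboundedOperators.heatExtension (w 0) (ν * t) =
      UnboundedOperators.heatExtension (u 0) (ν * t) :=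
    heatExtension_congr_ae (hwu 0 ⟨le_rfl, hT₁0⟩) _
  have hB_eq : ∀ x, oseenDuhamel ν 0 w w t x = oseenDuhamel ν 0 u u t x := fun x =>
    oseenDuhamel_congr_ae_slice (fun τ hτ => hwu τ ⟨hτ.1.le, hτ.2.trans htT₁⟩)
      (fun τ hτ => hwu τ ⟨hτ.1.le, hτ.2.trans htT₁⟩) x
  -- the three bounded pieces
  set h : EuclideanSpace ℝ (Fin 3) → EuclideanSpace ℝ (Fin 3) := UnboundedOperators.heatExtension (w 0) (ν * t) with hh
  set Bt : EuclideanSpace ℝ (Fin 3) → EuclideanSpace ℝ (Fin 3) := oseenDuhamel ν 0 w w t with hBt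
  have hνt : 0 < ν * t := mul_pos hν ht.1
  have hw0m : MemLp (w 0) ∞ (volume : Measure (EuclideanSpace ℝ (Fin 3))) :=
    memLp_top_of_bound (hwsl 0 ⟨le_rfl, hT₁0⟩) M (Eventually.of_forall (hwM 0))
  have hh_cont : Continuous h :=
    (UnboundedOperators.contDiff_heatExtension_holds hw0m le_top hνt).continuous
  have hh_bd : ∀ x, ‖h x‖ ≤ M := fun x => UnboundedOperators.norm_heatExtension_le (hwM 0) hνt x
  have hh_m : MemLp h ∞ (volume : Measure (EuclideanSpace ℝ (Fin 3))) :=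
    memLp_top_of_bound hh_cont.aestronglyMeasurable M (Eventually.of_forall hh_bd)
  obtain ⟨CB, hCB, hCBle⟩ := exists_norm_oseenDuhamel_bounded_le (E := EuclideanSpace ℝ (Fin 3))
  have hBt_bd : ∀ x, ‖Bt x‖ ≤ CB * M ^ 2 * ν ^ (-(1 / 2 : ℝ)) * (2 * Real.sqrt (t - 0)) := fun x =>
    hCBle hν ht.1 hM0.le (fun τ hτ y => hwM τ y) (fun τ hτ y => hwM τ y) x
  have hBt_meas : AEStronglyMeasurable Bt (volume : Measure (EuclideanSpace ℝ (Fin 3))) :=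
    aestronglyMeasurable_oseenDuhamel hν hwmeas hwmeas hM0.le hwM' hwM' ht.1 htT₁.le
  have hBt_m : MemLp Bt ∞ (volume : Measure (EuclideanSpace ℝ (Fin 3))) :=
    memLp_top_of_bound hBt_meas _ (Eventually.of_forall hBt_bd)
  have hwt_m : MemLp (w t) ∞ (volume : Measure (EuclideanSpace ℝ (Fin 3))) :=
    memLp_top_of_bound (hwsl t ⟨ht.1.le, htT₁⟩) M (Eventually.of_forall (hwM t))
  -- the field `z = h - Bt - w t`
  set z : EuclideanSpace ℝ (Fin 3) → EuclideanSpace ℝ (Fin 3) := fun x => h x - Bt x - w t x with hz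
  have hz_meas : AEStronglyMeasurable z volume :=
    (hh_cont.aestronglyMeasurable.sub hBt_meas).sub (hwsl t ⟨ht.1.le, htT₁⟩)
  have hz_bd : ∀ x, ‖z x‖ ≤ M + CB * M ^ 2 * ν ^ (-(1 / 2 : ℝ)) * (2 * Real.sqrt (t - 0)) + M := by
    intro x
    calc ‖z x‖ ≤ ‖h x - Bt x‖ + ‖w t x‖ := norm_sub_le _ _
      _ ≤ (‖h x‖ + ‖Bt x‖) + ‖w t x‖ := by gcongr; exact norm_sub_le _ _
      _ ≤ (M + CB * M ^ 2 * ν ^ (-(1 / 2 : ℝ)) * (2 * Real.sqrt (t - 0))) + M := by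
          gcongr
          · exact hh_bd x
          · exact hBt_bd x
          · exact hwM t x
  -- weak divergence freeness of `z`
  have hdiv0 : IsWeaklyDivFree (w 0) :=
    (hB.isWeaklyDivFree_zero hT).congr_ae (hwu 0 ⟨le_rfl, hT₁0⟩).symm
  have hdivh : IsWeaklyDivFree h := hdiv0.heatExtension_of_bound (hwsl 0 ⟨le_rfl, hT₁0⟩) (hwM 0) hνt
  have hdivB : IsWeaklyDivFree Bt :=
    isWeaklyDivFree_oseenDuhamel hν hwmeas hwmeas hM0.le hwM' hwM' ht.1 htT₁.le
  have hdivwt : IsWeaklyDivFree (w t) :=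
    (hB.mild.1 t ⟨ht.1.le, ht.2⟩).congr_ae (hwu t ⟨ht.1.le, htT₁⟩).symm
  have hz_div : IsWeaklyDivFree z := by
    have h1 : IsWeaklyDivFree (h - Bt) := IsWeaklyDivFree.sub le_top hdivh hdivB hh_m hBt_m
    have h2 : IsWeaklyDivFree (h - Bt - w t) := IsWeaklyDivFree.sub le_top h1 hdivwt (hh_m.sub hBt_m) hwt_m
    exact h2
  -- `z` annihilates divergence-free test fields: the duality identity at `t`
  have hmildw : IsMildNSSolutionOn (Ico 0 T₁) ν 0 (w 0) w :=
    (hB.mild.mono (Ico_subset_Ico_right hT₁T.le)).congr_ae_Ico hwu (hwu 0 ⟨le_rfl, hT₁0⟩)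
  have hz_orth : ∀ φ : EuclideanSpace ℝ (Fin 3) → EuclideanSpace ℝ (Fin 3), FunctionSpaces.IsTestFunctionOn (⊤ : Opens (EuclideanSpace ℝ (Fin 3))) φ →
      VectorCalculus.IsDivFree φ → ∫ x, ⟪z x, φ x⟫ = 0 := by
    intro φ hφ hφd
    have hφc := hφ.hasCompactSupport
    have hφcont := hφ.contDiff.continuous
    have key := hmildw.2 t ⟨ht.1.le, htT₁⟩ φ hφ hφd
    have hzero : (∫ τ in (0 : ℝ)..t, ∫ x, ⟪(0 : ℝ → EuclideanSpace ℝ (Fin 3) → EuclideanSpace ℝ (Fin 3)) τ x, heatTest ν φ (t - τ) x⟫) = 0 := by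
      simp
    rw [hzero, add_zero] at key
    -- the three pairings
    have e1 : ∫ x, ⟪h x, φ x⟫ = ∫ x, ⟪w 0 x, heatTest ν φ t x⟫ := by
      rw [hh, integral_inner_heatExtension_comm_of_bound (hwsl 0 ⟨le_rfl, hT₁0⟩) (hwM 0) hφcont hφc hνt,
        heatTest_of_pos hν ht.1]
    have e2 : ∫ x, ⟪Bt x, φ x⟫ =
        -∫ τ in (0 : ℝ)..t, ∫ y, ⟪w τ y, convect (w τ) (heatTest ν φ (t - τ)) y⟫ :=
      integral_inner_oseenDuhamel_eq_neg_intervalIntegral hν hwmeas hM0.le hwM' ht.1 htT₁.le hφ hφd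
    -- integrability of the pairings
    have i1 : Integrable (fun x => ⟪h x, φ x⟫) (volume : Measure (EuclideanSpace ℝ (Fin 3))) :=
      integrable_inner_of_hasCompactSupport_right hh_cont hφcont hφc
    have i2 : Integrable (fun x => ⟪Bt x, φ x⟫) (volume : Measure (EuclideanSpace ℝ (Fin 3))) :=
      integrable_inner_of_aestronglyMeasurable_of_norm_le hBt_meas hBt_bd
        (hφcont.integrable_of_hasCompactSupport hφc)
    have i3 : Integrable (fun x => ⟪w t x, φ x⟫) (volume : Measure (EuclideanSpace ℝ (Fin 3))) :=
      integrable_inner_of_aestronglyMeasurable_of_norm_le (hwsl t ⟨ht.1.le, htT₁⟩) (hwM t)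
        (hφcont.integrable_of_hasCompactSupport hφc)
    have i12 : Integrable (fun x => ⟪h x, φ x⟫ - ⟪Bt x, φ x⟫) (volume : Measure (EuclideanSpace ℝ (Fin 3))) := i1.sub i2
    have esplit : ∫ x, ⟪z x, φ x⟫ =
        (∫ x, ⟪h x, φ x⟫) - (∫ x, ⟪Bt x, φ x⟫) - ∫ x, ⟪w t x, φ x⟫ := by
      simp only [hz, inner_sub_left]
      rw [integral_sub i12 i3, integral_sub i1 i2]
    rw [esplit, e1, e2, key]
    ring
  -- the annihilator lemma
  obtain ⟨c, hc⟩ := hz_div.exists_ae_eq_const_of_norm_le_of_forall_integral_inner_eq_zero hz_meas hz_bd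
    hz_orth
  refine ⟨c, ?_⟩
  filter_upwards [hwu t ⟨ht.1.le, htT₁⟩, hc] with x hx hcx
  have : w t x = h x - Bt x - z x := by simp only [hz]; abel
  rw [← hx, this, hcx, hh_eq, hB_eq x]

end Drift






end Literature.Analysis.FluidPDE

end
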